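import Summits.QuantumFields.YangMills.Theorems.BalabanUVNodesN11TopPairRoughSet

/-!
# DAG node N11 — THE ROUGH WITNESS IS IN THE TREE: at this seat's re-pinned witness `rePinH θ` the main term of N11's first 𝐓-law has an ABSENT 𝐓-slot as soon as
# `SU(N)` has an element beyond the regularity threshold (`2εreg < dist1 g₀`) — and at the group of record `SU(2)` UNCONDITIONALLY in the group (numerics guards only)

HEADER — WORK-UNIT METADATA.  Cell `pub-ymgap`, YM-PLAN Track A (HUMAN RULING D-0062), seat `pub-ymgap-dag-n11-d` (g18; N11 [B14], s2), route `BalabanUVNodes`, item K1⁹ =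
stmt-QuantumFields-27364 (helper lane, `--kind proof --supports 27364 --as helper`, count-neutral).  [III] = [Balaban1988Convergent], [B7] = [Balaban1985Averaging], [I] = [Balaban1987RG1].
Sequel of this seat's g18 `…N11TopPairRoughSet` (§4 there: (O3′) at the top pair of `rePinH θ` ⇒ 𝐓-slot ≡ 0 ∨ `c₀ = 0` ∨ the rough all-(3.2)-small coarse fields are null; §3 there:
that set is non-null once ONE strictly cube-rough coarse field exists, and one exists once `SU(N)` has an element `g₀` with `t < dist1 g₀` — g5's `…N11SmallRegFirstStepFails`
positivity theorem over `Node00.CubeRoughSection`'s alternating coarse field and [I] (0.4)'s continuous averaging near its face section), g5's `…N11NoExpansionUnitBranch` (the χ₁-cubes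
cover the torus: a cube index exists), dag-n07-e's `su2_dist1_surj` (an element of `SU(2)` at every distance `≤ 2`).

WHY THIS FILE.  It DISCHARGES the two displayed letters of `…N11TopPairRoughSet.rePinH_main_term_absent_of_O3_of_exists_cubeRoughStrict` — the strictly cube-rough witness `V₀`
and the cube index `□′₀` — from the tree: (§1) at every `N`, from ONE group element `g₀` with `2εreg < dist1 g₀` (`1 ≤ M₂`); (§2) at `N = 2` (K1⁹'s group) from nothing but the
numerics guards, since `SU(2)` has an element at distance `2` and [B7] Prop. 2's range forces `2εreg < 2` at `d = 4`.  UPSHOT (located, count-neutral): for every `θ : Stage13HParams F 2`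
whose numerics meet the displayed guards (`εreg` in Prop. 2's range, grid `3·L·M₁ ≤ sideχ`, `1 ≤ M₁`, `1 ≤ M₂`, `0 < ε₁η₁²`, `ε₁η₁² + 8δ₀ ≤ α₀η₁²`, `α₀` in Prop. 2's range,
`2α₀(Lη₁)² ≤ 2εreg`, `0 < K`, `1 ≤ M`), the (O3′) clause of the TOP PAIR of N11's first 𝐓-law at the pins `rePinH θ` can hold only with a 𝐓-slot that is the zero function or vanishes
a.e. on its support — THE MAIN TERM OF THEOREM 1 IS NOT CARRIED BY THESE PINS (print reads `ζ(∅) = 1`; the pins read ζ at the base configuration: a design point for the ζ-slot of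
def-T ∕ K1⁹'s witness, recorded for the planners, not a defect claim about [III]).

WHAT THIS FILE PROVES (0 `def`, 0 `sorry`, standard axioms).  §1 `nonempty_Iχ` (`0 < sideχ`) · ★ `rough_support_ne_zero_of_lt_dist1` · ★★★ `rePinH_main_term_absent_of_O3_of_lt_dist1`
(every `N`; one `g₀ : SU N` with `2εreg < dist1 g₀`).  §2 ★★★★ `rePinH_main_term_absent_of_O3_su2` (`N = 2`: guards only).

HONEST FRAMING.  A NECESSARY-CONDITION reading at this seat's own witness family (count-neutral, LOCATED): nothing of Bałaban asserted or refuted; K1⁹'s `∃θ` untouched (other pins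
possible — e.g. ζ read at the pair configuration, or `ζ_0(∅) := 1`); N11 NOT discharged; K1⁹ NOT closed; no registered stub touched; counts unmoved (typed 28∕28 · discharged 5∕27 ·
A 5∕28).  One finite `𝕋⁴_{L^K}` programme at fixed `ε = L^{−K}` — NOT ℝ⁴, NOT OS, NOT a mass gap, NOT Clay.  No `sorry`, `axiom`, `def`, `instance`, `notation`.  Sources (SHAPE only):
[III] Thm 1 p.262, (3.1)–(3.5) pp.264–265, (3.25) p.270, (2.12) p.256, (2.17) p.257; [B7] Prop. 2 (52)–(54) p.26, (9)–(10) p.19; [I] (0.3)–(0.4) pp.252–253.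
-/

noncomputable section

open MeasureTheory
open scoped BigOperators Matrix.Norms.L2Operator

namespace Summit.QuantumFields.YangMills.Theorems.BalabanUVNodesN11TopPairRoughWitness

open Literature.MathematicalPhysics.QuantumFieldTheory.Balaban1983to89 T4Continuum Node00 Node00.Tk B14.Eq218Concrete B14.Sect3Decomp
open Literature.MathematicalPhysics.QuantumFieldTheory.Balaban1983to89.ExpMeanLog (deltaSU)
open B15DeterminingSets (pts)
open B14.Eq213MaximalDomains (side)
open GaugeField (plaqHol)
open BalabanUVNodesN11RePinnedParamDefs (rePinH)
open BalabanUVNodesN11AllLargeFieldLabel (sideχ_pos)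
open BalabanUVNodesN11TopPairRoughSet (rough_support_ne_zero_of_exists_cubeRoughStrict exists_cubeRoughStrict_of_lt_dist1 rePinH_main_term_absent_of_O3)
open Summit.QuantumFields.YangMills.BalabanUVNodes.N07Thm1ScaledInterfaceInstance (su2_dist1_surj)

variable {F : T4Family} {N : ℕ} [NeZero N]

/-! ## §1. Every `N`: one group element beyond the threshold -/

section AnyN

variable (ν : Stage7Numerics) (M : ℕ) (p : B12.RunParams) (g : ℕ → ℝ)

/-- The χ₁-cubes cover the torus, so a cube index exists (`0 < sideχ`). [cite: Balaban1988Convergent, (2.17) p.257, (3.2) p.265 (bookkeeping)] -/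
theorem nonempty_Iχ (hχ : 0 < sideχ F ν p g 0) : Nonempty (Iχ F ν p g 0) := by
  by_contra hne
  rw [not_nonempty_iff] at hne
  have hx : (fun _ => (0 : ZMod ((F.P p.K).sitesPerDir 0)) : Site (F.P p.K) 0) ∈ cubesχ F ν p g 0 (Finset.univ : Finset (Iχ F ν p g 0)) := by
    rw [cubesχ_univ F ν p g 0 hχ]; exact Set.mem_univ _
  simp only [cubesχ] at hx
  obtain ⟨c, -⟩ := Set.mem_iUnion.1 hx
  exact hne.elim c

/-- ★ **THE ROUGH ALL-(3.2)-SMALL SET IS NON-NULL FROM ONE GROUP ELEMENT BEYOND THE THRESHOLD** (`2εreg < dist1 g₀`, `t ≤ 2εreg`, `1 ≤ M₂`, unit-branch guards): g18's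
`rough_support_ne_zero_of_exists_cubeRoughStrict` with its witness supplied by `exists_cubeRoughStrict_of_lt_dist1` and its cube index by `nonempty_Iχ`.
[cite: Balaban1988Convergent, (3.2) p.265, (2.12) p.256, (2.17) p.257; Balaban1985Averaging, (9)–(10) p.19, Prop. 2 (54) p.26; Balaban1987RG1, (0.3)–(0.4) pp.252–253] -/
theorem rough_support_ne_zero_of_lt_dist1 (hε₁ : 0 < epsOfRecord ν g 1 * (F.P p.K).eta 1 ^ 2) (hmK : 1 ≤ (F.P p.K).m + (F.P p.K).K) (hε : 0 < ν.εreg)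
    (hε3 : (143 * (((((F.P p.K).d + 4 : ℕ) : ℝ)) ^ 2 / 4) ^ 2) * ν.εreg ≤ 1 / 3)
    (hε2 : 2 * ν.εreg ≤ 2 * deltaSU (Fin N) / ((((F.P p.K).d + 4) * (F.P p.K).L : ℕ) : ℝ) ^ 2)
    (hM1 : 1 ≤ ν.M₁) (hM₂ : 1 ≤ ν.M₂) (h3 : 3 * side (F.P p.K).L ν.M₁ 1 ≤ sideχ F ν p g 0) (g₀ : SU N) (hg₀ : 2 * ν.εreg < dist1 g₀) {t : ℝ} (ht : t ≤ 2 * ν.εreg)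
    (s' : SeqOfRecord F ν M g p.K 1) (hΩ : s'.Ω 1 = Set.univ) :
    fieldMeasure (F.P p.K) 1 (SU N) {V' | chiSeqOfRecord F N ν M g p.K 1 s' V' ≠ 0 ∧ ¬ PlaqSmall t V'} ≠ 0 := by
  obtain ⟨c₀⟩ := nonempty_Iχ ν p g (sideχ_pos hM₂ p g 0)
  exact rough_support_ne_zero_of_exists_cubeRoughStrict ν M p g hε₁ hmK hε hε3 hε2 hM1 h3 ht c₀ s' hΩ (exists_cubeRoughStrict_of_lt_dist1 ν p g hM₂ g₀ hg₀)

end AnyN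

section AnyNTest

variable (θ : Stage13HParams F N) (p : B12.RunParams)

/-- ★★★ **THE MAIN TERM IS ABSENT AT `rePinH θ` FROM ONE GROUP ELEMENT BEYOND THE THRESHOLD** (every `N`; `g₀ : SU N` with `2εreg < dist1 g₀`; the numerics guards displayed):
(O3′) at the top pair of `rePinH θ` ⇒ its 𝐓-slot is the zero function or vanishes a.e. on its support.
[cite: Balaban1988Convergent, Thm 1 p.262, (3.1)–(3.5) pp.264–265, (3.25) p.270, (2.12) p.256; Balaban1985Averaging, Prop. 2 (53)–(54) p.26, (10) p.19; Balaban1987RG1, (0.4) p.253] -/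
theorem rePinH_main_term_absent_of_O3_of_lt_dist1 (hM : 1 ≤ θ.τ9.M) (hM₂ : 0 < θ.ν.M₂) (hK : 0 < p.K) {α₀ : ℝ} (hα : 0 < α₀)
    (hα3 : (143 * (((((F.P p.K).d + 4 : ℕ) : ℝ)) ^ 2 / 4) ^ 2) * α₀ ≤ 1 / 3)
    (hα2 : 2 * α₀ ≤ 2 * deltaSU (Fin N) / ((((F.P p.K).d + 4) * (F.P p.K).L : ℕ) : ℝ) ^ 2)
    (hαε : epsOfRecord θ.ν (gOfRecord₁₃ F N θ.toStage13Params p) 1 * (F.P p.K).eta 1 ^ 2 + 4 * (2 * deltaOfRecord θ.ν (gOfRecord₁₃ F N θ.toStage13Params p) 0 θ.A₁) ≤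
      α₀ * (F.P p.K).eta 1 ^ 2)
    (hαr : 2 * α₀ * (((F.P p.K).L : ℝ) ^ 1 * (F.P p.K).eta 1) ^ 2 ≤ 2 * θ.ν.εreg)
    (hε₁ : 0 < epsOfRecord θ.ν (gOfRecord₁₃ F N θ.toStage13Params p) 1 * (F.P p.K).eta 1 ^ 2) (hmK : 1 ≤ (F.P p.K).m + (F.P p.K).K) (hε : 0 < θ.ν.εreg)
    (hε3 : (143 * (((((F.P p.K).d + 4 : ℕ) : ℝ)) ^ 2 / 4) ^ 2) * θ.ν.εreg ≤ 1 / 3)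
    (hε2 : 2 * θ.ν.εreg ≤ 2 * deltaSU (Fin N) / ((((F.P p.K).d + 4) * (F.P p.K).L : ℕ) : ℝ) ^ 2)
    (hM1 : 1 ≤ θ.ν.M₁) (h3 : 3 * side (F.P p.K).L θ.ν.M₁ 1 ≤ sideχ F θ.ν p (gOfRecord₁₃ F N θ.toStage13Params p) 0)
    (g₀ : SU N) (hg₀ : 2 * θ.ν.εreg < dist1 g₀)
    (s' : SeqOfRecord F θ.ν θ.τ9.M (gOfRecord₁₃ F N θ.toStage13Params p) p.K 1) (hΩ : s'.Ω 1 = Set.univ) (hΛ : s'.Λ 1 = Set.univ)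
    (u₁ : Sect2.TermValues (F.P p.K) (MatA N) (FluctV N) θ.τ9.M) (e₁ : ℝ)
    (hO3 : slotsTOfRecord F N θ.ν θ.τ9 (EOfRecord₁₃ F N θ.toStage13Params) (wOfRecord₉ F N θ.toStage9Params) θ.ppSel p (gOfRecord₁₃ F N θ.toStage13Params p) 1 s' = 0 ∨
      ∀ᵐ V' ∂fieldMeasure (F.P p.K) 1 (SU N),
        chiSeqOfRecord F N θ.ν θ.τ9.M (gOfRecord₁₃ F N θ.toStage13Params p) p.K 1 s' V' ≠ 0 →
          slotsTOfRecord F N θ.ν θ.τ9 (EOfRecord₁₃ F N θ.toStage13Params) (wOfRecord₉ F N θ.toStage9Params) θ.ppSel p (gOfRecord₁₃ F N θ.toStage13Params p) 1 s' V' =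
            sect2Slot F N (FluctV N) p.K (settingOfRecord₁₃ F N θ.toStage13Params p) ((rePinH θ).rzAt p s') (WtOfRecord₁₃H F N (rePinH θ) p s') s' u₁ e₁
              (UbgOfRecord₁₃CoP F N θ.toStage13Params p 1 s') V') :
    slotsTOfRecord F N θ.ν θ.τ9 (EOfRecord₁₃ F N θ.toStage13Params) (wOfRecord₉ F N θ.toStage9Params) θ.ppSel p (gOfRecord₁₃ F N θ.toStage13Params p) 1 s' = 0 ∨
      ∀ᵐ V' ∂fieldMeasure (F.P p.K) 1 (SU N),
        chiSeqOfRecord F N θ.ν θ.τ9.M (gOfRecord₁₃ F N θ.toStage13Params p) p.K 1 s' V' ≠ 0 →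
          slotsTOfRecord F N θ.ν θ.τ9 (EOfRecord₁₃ F N θ.toStage13Params) (wOfRecord₉ F N θ.toStage9Params) θ.ppSel p (gOfRecord₁₃ F N θ.toStage13Params p) 1 s' V' = 0 :=
  rePinH_main_term_absent_of_O3 θ p hM hM₂ hK hα hα3 hα2 hαε s' hΩ hΛ u₁ e₁
    (rough_support_ne_zero_of_lt_dist1 θ.ν θ.τ9.M p (gOfRecord₁₃ F N θ.toStage13Params p) hε₁ hmK hε hε3 hε2 hM1 hM₂ h3 g₀ hg₀ hαr s' hΩ) hO3

end AnyNTest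

/-! ## §2. The group of record `SU(2)`: guards only -/

section SU2

variable {F : T4Family} (θ : Stage13HParams F 2) (p : B12.RunParams)

/-- ★★★★ **AT `SU(2)` THE MAIN TERM IS ABSENT AT `rePinH θ`, GUARDS ONLY**: `SU(2)` has an element at distance `2` from `1` (dag-n07-e's `su2_dist1_surj`) and [B7] Prop. 2's range forces
`2εreg < 2` at `d = 4`; so for every `θ : Stage13HParams F 2` meeting the displayed numerics guards, (O3′) at the top pair of `rePinH θ` ⇒ its 𝐓-slot is the zero function or vanishes
a.e. on its support. [cite: Balaban1988Convergent, Thm 1 p.262, (3.1)–(3.5) pp.264–265, (3.25) p.270, (2.12) p.256; Balaban1985Averaging, Prop. 2 (52)–(54) p.26, (10) p.19; Balaban1987RG1, (0.4) p.253] -/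
theorem rePinH_main_term_absent_of_O3_su2 (hM : 1 ≤ θ.τ9.M) (hM₂ : 0 < θ.ν.M₂) (hK : 0 < p.K) {α₀ : ℝ} (hα : 0 < α₀)
    (hα3 : (143 * (((((F.P p.K).d + 4 : ℕ) : ℝ)) ^ 2 / 4) ^ 2) * α₀ ≤ 1 / 3)
    (hα2 : 2 * α₀ ≤ 2 * deltaSU (Fin 2) / ((((F.P p.K).d + 4) * (F.P p.K).L : ℕ) : ℝ) ^ 2)
    (hαε : epsOfRecord θ.ν (gOfRecord₁₃ F 2 θ.toStage13Params p) 1 * (F.P p.K).eta 1 ^ 2 + 4 * (2 * deltaOfRecord θ.ν (gOfRecord₁₃ F 2 θ.toStage13Params p) 0 θ.A₁) ≤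
      α₀ * (F.P p.K).eta 1 ^ 2)
    (hαr : 2 * α₀ * (((F.P p.K).L : ℝ) ^ 1 * (F.P p.K).eta 1) ^ 2 ≤ 2 * θ.ν.εreg)
    (hε₁ : 0 < epsOfRecord θ.ν (gOfRecord₁₃ F 2 θ.toStage13Params p) 1 * (F.P p.K).eta 1 ^ 2) (hmK : 1 ≤ (F.P p.K).m + (F.P p.K).K) (hε : 0 < θ.ν.εreg)
    (hε3 : (143 * (((((F.P p.K).d + 4 : ℕ) : ℝ)) ^ 2 / 4) ^ 2) * θ.ν.εreg ≤ 1 / 3)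
    (hε2 : 2 * θ.ν.εreg ≤ 2 * deltaSU (Fin 2) / ((((F.P p.K).d + 4) * (F.P p.K).L : ℕ) : ℝ) ^ 2)
    (hM1 : 1 ≤ θ.ν.M₁) (h3 : 3 * side (F.P p.K).L θ.ν.M₁ 1 ≤ sideχ F θ.ν p (gOfRecord₁₃ F 2 θ.toStage13Params p) 0)
    (s' : SeqOfRecord F θ.ν θ.τ9.M (gOfRecord₁₃ F 2 θ.toStage13Params p) p.K 1) (hΩ : s'.Ω 1 = Set.univ) (hΛ : s'.Λ 1 = Set.univ)
    (u₁ : Sect2.TermValues (F.P p.K) (MatA 2) (FluctV 2) θ.τ9.M) (e₁ : ℝ)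
    (hO3 : slotsTOfRecord F 2 θ.ν θ.τ9 (EOfRecord₁₃ F 2 θ.toStage13Params) (wOfRecord₉ F 2 θ.toStage9Params) θ.ppSel p (gOfRecord₁₃ F 2 θ.toStage13Params p) 1 s' = 0 ∨
      ∀ᵐ V' ∂fieldMeasure (F.P p.K) 1 (SU 2),
        chiSeqOfRecord F 2 θ.ν θ.τ9.M (gOfRecord₁₃ F 2 θ.toStage13Params p) p.K 1 s' V' ≠ 0 →
          slotsTOfRecord F 2 θ.ν θ.τ9 (EOfRecord₁₃ F 2 θ.toStage13Params) (wOfRecord₉ F 2 θ.toStage9Params) θ.ppSel p (gOfRecord₁₃ F 2 θ.toStage13Params p) 1 s' V' =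
            sect2Slot F 2 (FluctV 2) p.K (settingOfRecord₁₃ F 2 θ.toStage13Params p) ((rePinH θ).rzAt p s') (WtOfRecord₁₃H F 2 (rePinH θ) p s') s' u₁ e₁
              (UbgOfRecord₁₃CoP F 2 θ.toStage13Params p 1 s') V') :
    slotsTOfRecord F 2 θ.ν θ.τ9 (EOfRecord₁₃ F 2 θ.toStage13Params) (wOfRecord₉ F 2 θ.toStage9Params) θ.ppSel p (gOfRecord₁₃ F 2 θ.toStage13Params p) 1 s' = 0 ∨
      ∀ᵐ V' ∂fieldMeasure (F.P p.K) 1 (SU 2),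
        chiSeqOfRecord F 2 θ.ν θ.τ9.M (gOfRecord₁₃ F 2 θ.toStage13Params p) p.K 1 s' V' ≠ 0 →
          slotsTOfRecord F 2 θ.ν θ.τ9 (EOfRecord₁₃ F 2 θ.toStage13Params) (wOfRecord₉ F 2 θ.toStage9Params) θ.ppSel p (gOfRecord₁₃ F 2 θ.toStage13Params p) 1 s' V' = 0 := by
  obtain ⟨g₀, hg₀⟩ := su2_dist1_surj 2 zero_le_two le_rfl
  have hd : (F.P p.K).d = 4 := rfl
  have hεlt : 2 * θ.ν.εreg < dist1 g₀ := by
    rw [hg₀]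
    rw [hd] at hε3
    norm_num at hε3
    linarith
  exact rePinH_main_term_absent_of_O3_of_lt_dist1 θ p hM hM₂ hK hα hα3 hα2 hαε hαr hε₁ hmK hε hε3 hε2 hM1 h3 g₀ hεlt s' hΩ hΛ u₁ e₁ hO3

end SU2

end Summit.QuantumFields.YangMills.Theorems.BalabanUVNodesN11TopPairRoughWitness

end
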